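import Summits.QuantumFields.QCD.Theses.HeatSlicedQuarks
import Summits.QuantumFields.QCD.Theorems.HeatSlicedQuarksQuarkLoopCoefficientDefs
import Summits.QuantumFields.QCD.Theorems.HeatSlicedQuarksQuarkLoopCoefficientHeatSeries

/-!
# Free heat calculus on `ℤ⁴`, part E: uniqueness for bounded solutions of the lattice heat equation
(line `Sketch` of crux stmt-QuantumFields-16786, helper file of the stub `stub_freeHeatCalculus`)

**Uniqueness** (`lattice_heat_unique`): a family `X : ℝ → ℤ⁴ → E` (values in a complete real normed space)
solving the lattice heat equation `∂_s X_s(w) = −Σ_{z ∈ nbr2 0} ĥ(z) • X_s(w − z)` on `[0, T]`, bounded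
uniformly in `(s, w)`, with `X_0 = 0`, vanishes on `[0, T]`.  Proof: Picard iteration
`‖X_s(w)‖ ≤ M (K s)ⁿ / n!` with `K = Σ_z |ĥ(z)|` (fundamental theorem of calculus pointwise in `w`; no
Banach-space valued calculus is needed), and `(K s)ⁿ / n! → 0`.  This is the device by which the line
identifies kernels without multi-dimensional Fourier inversion (conjuncts (2), (5), (6) of
`FreeHeatCalculus`).
-/

noncomputable section

namespace Summit.QuantumFields.QCD.Cruxes.QuarkLoopCoefficient.Sketch.FreeHeatCalculus

open Literature.MathematicalPhysics.QuantumLattice Literature.MathematicalPhysics.QuantumFieldTheory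
open Literature.Probability.LatticeModels (Site)
open Summit.QuantumFields.QCD.Theorems.QuarkLoopCoefficient
open Summit.QuantumFields.QCD.Cruxes.QuarkLoopCoefficient.Sketch.HeatSeries
open MeasureTheory
open scoped Matrix ComplexConjugate

/-! ## §1 Uniqueness for bounded solutions of the lattice heat equation -/

section Uniqueness

variable {E : Type*} [NormedAddCommGroup E] [NormedSpace ℝ E] [CompleteSpace E]

/-- **Picard iteration bound**: a bounded solution of `∂_s X = −ĥ ∗ X` on `[0,T]` with `X_0 = 0`
satisfies `‖X_s(w)‖ ≤ M (K s)ⁿ / n!` for every `n`, where `K = Σ_{z ∈ nbr2 0} |ĥ(z)|`. -/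
theorem lattice_heat_picard {X : ℝ → Site 4 → E} {T M : ℝ}
    (hderiv : ∀ s ∈ Set.Icc 0 T, ∀ w : Site 4,
      HasDerivAt (fun r => X r w) (-(∑ z ∈ nbr2 0, hhat z • X s (w - z))) s)
    (hbound : ∀ s ∈ Set.Icc 0 T, ∀ w : Site 4, ‖X s w‖ ≤ M)
    (h0 : ∀ w : Site 4, X 0 w = 0) :
    ∀ (n : ℕ), ∀ s ∈ Set.Icc 0 T, ∀ w : Site 4,
      ‖X s w‖ ≤ M * ((∑ z ∈ nbr2 0, |hhat z|) * s) ^ n / n.factorial := by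
  set K : ℝ := ∑ z ∈ nbr2 0, |hhat z| with hK
  have hcont : ∀ v : Site 4, ContinuousOn (fun r => X r v) (Set.Icc 0 T) := fun v r hr =>
    (hderiv r hr v).continuousAt.continuousWithinAt
  intro n
  induction n with
  | zero =>
    intro s hs w
    simpa using hbound s hs w
  | succ n ih =>
    intro s hs w
    have hs0 : 0 ≤ s := hs.1
    have hsub : Set.Icc 0 s ⊆ Set.Icc 0 T := Set.Icc_subset_Icc le_rfl hs.2
    -- fundamental theorem of calculus on `[0, s]`
    have hderiv' : ∀ r ∈ Set.uIcc 0 s,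
        HasDerivAt (fun r => X r w) (-(∑ z ∈ nbr2 0, hhat z • X r (w - z))) r := by
      intro r hr
      rw [Set.uIcc_of_le hs0] at hr
      exact hderiv r (hsub hr) w
    have hcontF : ContinuousOn (fun r => -(∑ z ∈ nbr2 0, hhat z • X r (w - z))) (Set.uIcc 0 s) := by
      rw [Set.uIcc_of_le hs0]
      exact (continuousOn_finsetSum _ fun z _ => ((hcont (w - z)).mono hsub).const_smul (hhat z)).neg
    have hftc := intervalIntegral.integral_eq_sub_of_hasDerivAt hderiv' hcontF.intervalIntegrable
    rw [h0 w, sub_zero] at hftc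
    rw [← hftc]
    -- bound the integral by the Picard majorant
    have hle : ‖∫ r in (0 : ℝ)..s, -(∑ z ∈ nbr2 0, hhat z • X r (w - z))‖ ≤
        ∫ r in (0 : ℝ)..s, M * K * (K * r) ^ n / n.factorial := by
      refine intervalIntegral.norm_integral_le_of_norm_le hs0 (ae_of_all _ fun r hr => ?_) ?_
      · have hr' : r ∈ Set.Icc 0 T := ⟨hr.1.le, hr.2.trans hs.2⟩
        rw [norm_neg]
        calc ‖∑ z ∈ nbr2 0, hhat z • X r (w - z)‖
            ≤ ∑ z ∈ nbr2 0, ‖hhat z • X r (w - z)‖ := norm_sum_le _ _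
          _ ≤ ∑ z ∈ nbr2 0, |hhat z| * (M * (K * r) ^ n / n.factorial) :=
              Finset.sum_le_sum fun z _ => by
                rw [norm_smul, Real.norm_eq_abs]
                exact mul_le_mul_of_nonneg_left (ih r hr' (w - z)) (abs_nonneg _)
          _ = M * K * (K * r) ^ n / n.factorial := by rw [← Finset.sum_mul]; ring
      · exact (by fun_prop : Continuous fun r : ℝ => M * K * (K * r) ^ n / n.factorial).intervalIntegrable _ _
    refine hle.trans (le_of_eq ?_)
    have hI : ∫ r in (0 : ℝ)..s, M * K * (K * r) ^ n / n.factorial =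
        (M * K * K ^ n / n.factorial) * ∫ r in (0 : ℝ)..s, r ^ n := by
      rw [← intervalIntegral.integral_const_mul]
      refine intervalIntegral.integral_congr fun r _ => ?_
      simp only [mul_pow]
      ring
    rw [hI, integral_pow, zero_pow (Nat.succ_ne_zero n), sub_zero, Nat.factorial_succ]
    push_cast
    field_simp
    ring

/-- **Uniqueness for bounded solutions of the lattice heat equation**: if `X` solves
`∂_s X_s(w) = −Σ_{z ∈ nbr2 0} ĥ(z) • X_s(w − z)` on `[0,T]`, is bounded there uniformly in `(s, w)` and
vanishes at `s = 0`, then `X ≡ 0` on `[0,T]`. -/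
theorem lattice_heat_unique {X : ℝ → Site 4 → E} {T M : ℝ}
    (hderiv : ∀ s ∈ Set.Icc 0 T, ∀ w : Site 4,
      HasDerivAt (fun r => X r w) (-(∑ z ∈ nbr2 0, hhat z • X s (w - z))) s)
    (hbound : ∀ s ∈ Set.Icc 0 T, ∀ w : Site 4, ‖X s w‖ ≤ M)
    (h0 : ∀ w : Site 4, X 0 w = 0) :
    ∀ s ∈ Set.Icc 0 T, ∀ w : Site 4, X s w = 0 := by
  intro s hs w
  have key := fun n => lattice_heat_picard hderiv hbound h0 n s hs w
  have hlim : Filter.Tendsto (fun n : ℕ => M * (((∑ z ∈ nbr2 0, |hhat z|) * s) ^ n / n.factorial))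
      Filter.atTop (nhds (M * 0)) :=
    (FloorSemiring.tendsto_pow_div_factorial_atTop _).const_mul M
  rw [mul_zero] at hlim
  have : ‖X s w‖ ≤ 0 := ge_of_tendsto' hlim fun n => by rw [← mul_div_assoc]; exact key n
  exact norm_le_zero_iff.mp this

end Uniqueness

/-! ## Registered headline -/

/-- Registered headline of this helper file (aux stub `stub_freeHeatCalculusAuxE` of crux
stmt-QuantumFields-16786, line `Sketch`): uniqueness of bounded real solutions of the lattice heat
equation with zero initial value. -/
theorem stub_freeHeatCalculusAuxE :
    ∀ (X : ℝ → Site 4 → ℝ) (T M : ℝ),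
      (∀ s ∈ Set.Icc 0 T, ∀ w : Site 4,
        HasDerivAt (fun r => X r w) (-(∑ z ∈ nbr2 0, hhat z * X s (w - z))) s) →
      (∀ s ∈ Set.Icc 0 T, ∀ w : Site 4, |X s w| ≤ M) → (∀ w : Site 4, X 0 w = 0) →
      ∀ s ∈ Set.Icc 0 T, ∀ w : Site 4, X s w = 0 :=
  fun _ _ _ hderiv hbound h0 => lattice_heat_unique hderiv hbound h0

end Summit.QuantumFields.QCD.Cruxes.QuarkLoopCoefficient.Sketch.FreeHeatCalculus

end
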